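import Summits.CriticalPhenomena.PercolationContinuityZ3.Theorems.Transplant.FKConnectivityAllQHubCov
import HarnessLib

/-!
# Connectivity correlation inequalities for `φ_{w,q}`, every `q > 0` — the hub covariance bound REDUCED TO COUNTING
# two-colourings fiber by fiber (the "coefficientwise" form)

Support file (`--supports stmt-CriticalPhenomena-4575`), FK sub-lane `prim-bschramm-fk-1` (gen 6) of the post-continuity
programme; builds on p205010 (kernel theorem, internal audit signed; external expert review pending).  No definitions, no named
facts, no sorries; standard axioms.

fk-3's hub covariance bound `HubCovBoundUnder (φ_U) q x y z` (`…AllQHubCov.lean`; for `0 < q < 1` equivalent to negative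
correlation of the adjacent pairs `xy, xz`, hence the route to the conjecture nodes `HubCovBoundFKLtOne` / `EdgeNegCorrAdjFKLtOne`) is,
in mass form, `0 ≤ E := Byz·(Z − (1−q)C) − (1−q)(A·C − Bxy·Bxz)` (five partition-pattern masses of `{x,y,z}` under `U`).  Here:
* `FK.weight_mul_weight_eq_fiber` — the product weight of a PAIR of configurations depends only on the FIBER
  `(ω₁ ∩ ω₂, ω₁ ∪ ω₂)`: `W(ω₁)W(ω₂) = ∏_g [g ∈ I: p_g²; g ∈ U∖I: p_g(1−p_g); g ∉ U: (1−p_g)²]`.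
* `FK.threePoint_eq_fiber_sum` — `E = Σ_{(I,U)} c(I,U) · P_{I,U}(q)` with `c ≥ 0` and the FIBER POLYNOMIAL
  `P_{I,U}(q) = Σ_{(ω₁,ω₂) in the fiber} q^{k(ω₁)+k(ω₂)} σ(ω₁,ω₂)`,
  `σ = 1_{x∤y~z}(ω₁) + (1−q)·(1_{xy|z}(ω₁)1_{xz|y}(ω₂) − 1_{xyz}(ω₁)(1_{x∤y~z}(ω₂) + 1_{x|y|z}(ω₂)))`.
* **`FK.fiberPoly_nonneg_of_count`** — the COUNTING CRITERION: if for every level `j`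
  `#{bad pairs at level j} ≤ #{good 'C' pairs at level ≤ j} + #{good 'AB' pairs at level j}`
  (bad = `ω₁ ∈ xyz`, `ω₂ ∈ x∤y~z ∪ x|y|z`; good C = `ω₁ ∈ x∤y~z`; good AB = `ω₁ ∈ xy|z`, `ω₂ ∈ xz|y`; level = `k(ω₁)+k(ω₂)`),
  then `P ≥ 0` on `[0,1]` — because `q^k = (1−q)Σ_{j≥k} q^j`: a C-pair pays for one bad pair at every level `≥` its own.
* **`FK.hubCovBoundUnder_of_fiberCount`** (`0 < q ≤ 1`) — the counting criterion on every fiber of the weight vector's ground set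
  gives `HubCovBoundUnder (rcMeasureW U q ∅) q x y z`.
So the hub covariance bound / adjacent-pair negative correlation for ALL `q ∈ (0,1)` on a graph follows from a `q`-FREE COUNTING
STATEMENT about two-colourings of its edge fibers.  EVIDENCE (this seat, exact integer arithmetic, bschramm/FROM-fk-1-g6-TWO-SUM.md
§4): the criterion holds for every fiber on `≤ 6` vertices (all 33,860 labelled simple graphs with a marked hub triple) and for all
multigraph fibers on `≤ 4` vertices (multiplicity `≤ 3`, `≤ 12` edges; 3,668) and on `5` vertices (multiplicity `≤ 2`, `≤ 10` edges;
33,654): 0 failures.  Nothing is claimed beyond that; the counting statement is the combinatorial target (an injection inside each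
interval of the edge lattice), the random-cluster form of Wagner's coefficientwise Conjectures 5.3/5.4.
[cite: Wagner2006, Conj. 5.3, Conj. 5.4, Ex. 5.2 (p. 13)] [cite: Grimmett2006, §3.9 eq. (3.94), Conj. (3.96) (pp. 63–66); §1.4 eq. (1.20) (p. 15)]
-/

noncomputable section

namespace Summit.CriticalPhenomena.PercolationContinuityZ3.Theorems

namespace FK

open MeasureTheory Finset Literature.Probability.LatticeModels Literature.Probability.Percolation
open Literature.Probability.Percolation.BHK2006 (weight weight_nonneg)
open Literature.Probability.Percolation.DecisionTree (ind ind_of_mem ind_of_not_mem ind_nonneg)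
open scoped Classical

variable {V : Type*} [Fintype V]

/-! ### The product weight of a pair depends only on its fiber -/

/-- **Pair weights are fiber constants**: `W(ω₁)·W(ω₂) = ∏_g c_g(ω₁ ∩ ω₂, ω₁ ∪ ω₂)` with `c_g(I,U) = p_g²` on `I`, `p_g(1−p_g)`
on `U ∖ I`, `(1−p_g)²` off `U`. [cite: Grimmett2006, §1.4 eq. (1.20) (p. 15)] -/
theorem weight_mul_weight_eq_fiber (p : Sym2 V → ℝ) (ω₁ ω₂ : BondConfig V) :
    weight p ω₁ * weight p ω₂ =
      ∏ g : Sym2 V, (if g ∈ ω₁ ∩ ω₂ then p g * p g else if g ∈ ω₁ ∪ ω₂ then p g * (1 - p g) else (1 - p g) * (1 - p g)) := by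
  unfold weight
  rw [← Finset.prod_mul_distrib]
  refine Finset.prod_congr rfl fun g _ => ?_
  by_cases h1 : g ∈ ω₁ <;> by_cases h2 : g ∈ ω₂ <;>
    simp [h1, h2, Set.mem_inter_iff, Set.mem_union, mul_comm]

/-- The fiber constant is nonnegative for parameters in `[0,1]`. [folklore] -/
theorem fiberWeight_nonneg (p : Sym2 V → ℝ) (hp0 : ∀ g, 0 ≤ p g) (hp1 : ∀ g, p g ≤ 1) (I U : BondConfig V) :
    0 ≤ ∏ g : Sym2 V, (if g ∈ I then p g * p g else if g ∈ U then p g * (1 - p g) else (1 - p g) * (1 - p g)) := by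
  refine Finset.prod_nonneg fun g _ => ?_
  have h0 := hp0 g; have h1 := hp1 g
  split_ifs <;> nlinarith

/-! ### Regrouping the three-point expression by fibers -/

section Fiber

variable (U : Sym2 V → unitInterval) (q : ℝ) (x y z : V)

/-- Products of two masses as a double sum. [cite: Grimmett2006, §1.4 eq. (1.20) (p. 15)] -/
theorem mass_mul_mass_eq_sum (a b : BondConfig V → ℝ) :
    (∑ ω : BondConfig V, rcWeightW U q ∅ ω * a ω) * (∑ ω : BondConfig V, rcWeightW U q ∅ ω * b ω) =
      ∑ pr : BondConfig V × BondConfig V, rcWeightW U q ∅ pr.1 * rcWeightW U q ∅ pr.2 * (a pr.1 * b pr.2) := by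
  rw [Finset.sum_mul_sum, ← Finset.univ_product_univ, Finset.sum_product]
  exact Finset.sum_congr rfl fun ω₁ _ => Finset.sum_congr rfl fun ω₂ _ => by ring

/-- The weight of a pair: fiber constant times `q^{k(ω₁)+k(ω₂)}`. [cite: Grimmett2006, §1.4 eq. (1.20) (p. 15)] -/
theorem rcWeightW_mul_rcWeightW (ω₁ ω₂ : BondConfig V) :
    rcWeightW U q ∅ ω₁ * rcWeightW U q ∅ ω₂ =
      (∏ g : Sym2 V, (if g ∈ ω₁ ∩ ω₂ then (U g : ℝ) * (U g : ℝ) else if g ∈ ω₁ ∪ ω₂ then (U g : ℝ) * (1 - (U g : ℝ))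
        else (1 - (U g : ℝ)) * (1 - (U g : ℝ)))) * q ^ (clusterCount ω₁ ∅ + clusterCount ω₂ ∅) := by
  rw [rcWeightW, rcWeightW, pow_add, ← weight_mul_weight_eq_fiber]
  ring

/-- **The three-point expression as a fiber sum**: with the sign function
`σ(ω₁,ω₂) = 1_{x∤y~z}(ω₁) + (1−q)(1_{xy|z}(ω₁)1_{xz|y}(ω₂) − 1_{xyz}(ω₁)(1_{x∤y~z}(ω₂) + 1_{x|y|z}(ω₂)))`,
`Byz(Z − (1−q)C) − (1−q)(AC − Bxy·Bxz) = Σ_{(I,J)} c(I,J) · Σ_{(ω₁,ω₂): ω₁∩ω₂ = I, ω₁∪ω₂ = J} q^{k(ω₁)+k(ω₂)} σ(ω₁,ω₂)`.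
[cite: Wagner2006, Ex. 5.2, Conj. 5.3 (p. 13)] [cite: Grimmett2006, §1.4 eq. (1.20) (p. 15)] -/
theorem threePoint_eq_fiber_sum :
    (∑ ω : BondConfig V, rcWeightW U q ∅ ω * ind ((openConn x y : Set (BondConfig V))ᶜ ∩ openConn y z) ω) *
          (rcPartitionFunctionW U q ∅ -
            (1 - q) * ∑ ω : BondConfig V, rcWeightW U q ∅ ω * ind (openConn x y ∩ openConn x z) ω) -
        (1 - q) *
          ((∑ ω : BondConfig V, rcWeightW U q ∅ ω *
              ind ((openConn x y : Set (BondConfig V))ᶜ ∩ (openConn x z : Set (BondConfig V))ᶜ ∩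
                (openConn y z : Set (BondConfig V))ᶜ) ω) *
            (∑ ω : BondConfig V, rcWeightW U q ∅ ω * ind (openConn x y ∩ openConn x z) ω) -
           (∑ ω : BondConfig V, rcWeightW U q ∅ ω * ind (openConn x y ∩ (openConn x z : Set (BondConfig V))ᶜ) ω) *
            (∑ ω : BondConfig V, rcWeightW U q ∅ ω * ind ((openConn x y : Set (BondConfig V))ᶜ ∩ openConn x z) ω)) =
      ∑ d : BondConfig V × BondConfig V,
        (∏ g : Sym2 V, (if g ∈ d.1 then (U g : ℝ) * (U g : ℝ) else if g ∈ d.2 then (U g : ℝ) * (1 - (U g : ℝ))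
          else (1 - (U g : ℝ)) * (1 - (U g : ℝ)))) *
        ∑ pr ∈ (Finset.univ : Finset (BondConfig V × BondConfig V)).filter (fun pr => (pr.1 ∩ pr.2, pr.1 ∪ pr.2) = d),
          q ^ (clusterCount pr.1 ∅ + clusterCount pr.2 ∅) *
            (ind ((openConn x y : Set (BondConfig V))ᶜ ∩ openConn y z) pr.1 +
              (1 - q) * (ind (openConn x y ∩ (openConn x z : Set (BondConfig V))ᶜ) pr.1 *
                  ind ((openConn x y : Set (BondConfig V))ᶜ ∩ openConn x z) pr.2 -
                ind (openConn x y ∩ openConn x z) pr.1 *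
                  (ind ((openConn x y : Set (BondConfig V))ᶜ ∩ openConn y z) pr.2 +
                    ind ((openConn x y : Set (BondConfig V))ᶜ ∩ (openConn x z : Set (BondConfig V))ᶜ ∩
                      (openConn y z : Set (BondConfig V))ᶜ) pr.2))) := by
  -- Step 1: the left side as ONE double sum
  have hZ : rcPartitionFunctionW U q ∅ = ∑ ω : BondConfig V, rcWeightW U q ∅ ω * (1 : ℝ) := by
    unfold rcPartitionFunctionW; simp
  set r := fun ω : BondConfig V => rcWeightW U q ∅ ω with hr
  set iC := fun ω : BondConfig V => ind ((openConn x y : Set (BondConfig V))ᶜ ∩ openConn y z) ω with hiC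
  set iT := fun ω : BondConfig V => ind (openConn x y ∩ openConn x z) ω with hiT
  set iN := fun ω : BondConfig V => ind ((openConn x y : Set (BondConfig V))ᶜ ∩ (openConn x z : Set (BondConfig V))ᶜ ∩
    (openConn y z : Set (BondConfig V))ᶜ) ω with hiN
  set iA := fun ω : BondConfig V => ind (openConn x y ∩ (openConn x z : Set (BondConfig V))ᶜ) ω with hiA
  set iB := fun ω : BondConfig V => ind ((openConn x y : Set (BondConfig V))ᶜ ∩ openConn x z) ω with hiB
  have e1 := mass_mul_mass_eq_sum U q iC (fun _ => (1 : ℝ))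
  have e2 := mass_mul_mass_eq_sum U q iT iC
  have e3 := mass_mul_mass_eq_sum U q iT iN
  have e4 := mass_mul_mass_eq_sum U q iA iB
  have lhs : (∑ ω : BondConfig V, r ω * iC ω) * ((∑ ω : BondConfig V, r ω * 1) - (1 - q) * ∑ ω : BondConfig V, r ω * iT ω) -
      (1 - q) * ((∑ ω : BondConfig V, r ω * iN ω) * (∑ ω : BondConfig V, r ω * iT ω) -
        (∑ ω : BondConfig V, r ω * iA ω) * (∑ ω : BondConfig V, r ω * iB ω)) =
      ∑ pr : BondConfig V × BondConfig V, r pr.1 * r pr.2 *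
        (iC pr.1 + (1 - q) * (iA pr.1 * iB pr.2 - iT pr.1 * (iC pr.2 + iN pr.2))) := by
    have c0 : (∑ ω : BondConfig V, r ω * iC ω) * ((∑ ω : BondConfig V, r ω * 1) - (1 - q) * ∑ ω : BondConfig V, r ω * iT ω) -
        (1 - q) * ((∑ ω : BondConfig V, r ω * iN ω) * (∑ ω : BondConfig V, r ω * iT ω) -
          (∑ ω : BondConfig V, r ω * iA ω) * (∑ ω : BondConfig V, r ω * iB ω)) =
        (∑ ω : BondConfig V, r ω * iC ω) * (∑ ω : BondConfig V, r ω * 1) +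
          (1 - q) * ((∑ ω : BondConfig V, r ω * iA ω) * (∑ ω : BondConfig V, r ω * iB ω) -
            (∑ ω : BondConfig V, r ω * iT ω) * (∑ ω : BondConfig V, r ω * iC ω) -
            (∑ ω : BondConfig V, r ω * iT ω) * (∑ ω : BondConfig V, r ω * iN ω)) := by ring
    rw [c0, e1, e2, e3, e4, ← Finset.sum_sub_distrib, ← Finset.sum_sub_distrib, Finset.mul_sum, ← Finset.sum_add_distrib]
    exact Finset.sum_congr rfl fun pr _ => by ring
  rw [hZ, lhs]
  -- Step 2: regroup by fibers
  rw [← Finset.sum_fiberwise_of_maps_to (s := (Finset.univ : Finset (BondConfig V × BondConfig V)))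
    (t := (Finset.univ : Finset (BondConfig V × BondConfig V))) (g := fun pr => (pr.1 ∩ pr.2, pr.1 ∪ pr.2))
    (fun _ _ => Finset.mem_univ _)]
  refine Finset.sum_congr rfl fun d _ => ?_
  rw [Finset.mul_sum]
  refine Finset.sum_congr rfl fun pr hpr => ?_
  have hd : (pr.1 ∩ pr.2, pr.1 ∪ pr.2) = d := (Finset.mem_filter.1 hpr).2
  subst hd
  rw [hr, hiC, hiT, hiN, hiA, hiB]
  simp only
  rw [rcWeightW_mul_rcWeightW U q pr.1 pr.2]
  ring

end Fiber

/-! ### The counting criterion for one fiber -/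

/-- `(1 − q)·Σ_{j = k}^{M} q^j = q^k − q^{M+1} ≤ q^k` for `0 ≤ q`, `k ≤ M + 1`. [folklore] -/
theorem one_sub_mul_geom_Ico (q : ℝ) (k M : ℕ) :
    (1 - q) * ∑ j ∈ Finset.Ico k (M + 1), q ^ j = q ^ k * (1 - q ^ (M + 1 - k)) := by
  by_cases hk : k ≤ M + 1
  · rw [Finset.sum_Ico_eq_sum_range]
    have : ∑ j ∈ Finset.range (M + 1 - k), q ^ (k + j) = q ^ k * ∑ j ∈ Finset.range (M + 1 - k), q ^ j := by
      rw [Finset.mul_sum]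
      exact Finset.sum_congr rfl fun j _ => pow_add q k j
    rw [this, ← mul_assoc, mul_comm (1 - q), mul_assoc, mul_neg_geom_sum]
  · rw [not_le] at hk
    have h0 : M + 1 - k = 0 := by omega
    rw [h0, Finset.Ico_eq_empty (by omega)]
    simp

/-- **The counting criterion implies nonnegativity of the fiber polynomial.**  On a finite set `S` of pairs with a level
function `κ`, a "C-good" predicate, an "AB-good" predicate and a "bad" predicate: if at every level `j` the bad pairs of level `j`
are at most the C-good pairs of level `≤ j` plus the AB-good pairs of level `j`, then for `0 ≤ q ≤ 1`
`0 ≤ Σ_{p ∈ S} q^{κ p} (1_C(p) + (1−q)(1_{AB}(p) − 1_{bad}(p)))` (a C-good pair pays `q^{κ} ≥ (1−q)Σ_{j ≥ κ} q^j`, one unit at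
every level above its own). [cite: Wagner2006, Conj. 5.3 (p. 13)] -/
theorem fiberPoly_nonneg_of_count {ι : Type*} (S : Finset ι) (κ : ι → ℕ) (isC isAB isBad : ι → Prop) [DecidablePred isC]
    [DecidablePred isAB] [DecidablePred isBad] {q : ℝ} (hq0 : 0 ≤ q) (hq1 : q ≤ 1)
    (hcount : ∀ j : ℕ, ((S.filter fun p => isBad p ∧ κ p = j).card : ℝ) ≤
      ((S.filter fun p => isC p ∧ κ p ≤ j).card : ℝ) + ((S.filter fun p => isAB p ∧ κ p = j).card : ℝ)) :
    0 ≤ ∑ p ∈ S, q ^ κ p * ((if isC p then (1 : ℝ) else 0) +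
      (1 - q) * ((if isAB p then (1 : ℝ) else 0) - (if isBad p then (1 : ℝ) else 0))) := by
  -- a common top level
  set M := S.sup κ with hM
  have hκM : ∀ p ∈ S, κ p ≤ M := fun p hp => Finset.le_sup hp
  have h1q : 0 ≤ 1 - q := by linarith
  -- level decomposition of each of the three sums
  have lev : ∀ (P : ι → Prop) [DecidablePred P], ∑ p ∈ S, q ^ κ p * (if P p then (1 : ℝ) else 0) =
      ∑ j ∈ Finset.range (M + 1), q ^ j * ((S.filter fun p => P p ∧ κ p = j).card : ℝ) := by
    intro P _
    have : ∀ p ∈ S, q ^ κ p * (if P p then (1 : ℝ) else 0) =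
        ∑ j ∈ Finset.range (M + 1), (if P p ∧ κ p = j then q ^ j else 0) := by
      intro p hp
      rw [Finset.sum_ite, Finset.sum_const_zero, add_zero]
      by_cases hP : P p
      · have hfil : (Finset.range (M + 1)).filter (fun j => P p ∧ κ p = j) = {κ p} := by
          ext j
          simp only [Finset.mem_filter, Finset.mem_range, Finset.mem_singleton, hP, true_and]
          constructor
          · rintro ⟨-, h⟩; exact h.symm
          · rintro rfl; exact ⟨Nat.lt_succ_of_le (hκM p hp), rfl⟩
        rw [hfil, Finset.sum_singleton, if_pos hP, mul_one]
      · rw [if_neg hP, mul_zero]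
        have hfil : (Finset.range (M + 1)).filter (fun j => P p ∧ κ p = j) = ∅ := by
          ext j; simp [hP]
        rw [hfil, Finset.sum_empty]
    rw [Finset.sum_congr rfl this, Finset.sum_comm]
    refine Finset.sum_congr rfl fun j _ => ?_
    rw [Finset.card_filter, Nat.cast_sum, Finset.mul_sum]
    refine Finset.sum_congr rfl fun p _ => ?_
    by_cases h : P p ∧ κ p = j
    · rw [if_pos h, if_pos h, Nat.cast_one, mul_one]
    · rw [if_neg h, if_neg h, Nat.cast_zero, mul_zero]
  -- the C-sum dominates the cumulative count
  have domC : (1 - q) * ∑ j ∈ Finset.range (M + 1), q ^ j * ((S.filter fun p => isC p ∧ κ p ≤ j).card : ℝ) ≤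
      ∑ p ∈ S, q ^ κ p * (if isC p then (1 : ℝ) else 0) := by
    -- rewrite the cumulative count as a sum over `p` of the geometric tail
    have hcum : ∑ j ∈ Finset.range (M + 1), q ^ j * ((S.filter fun p => isC p ∧ κ p ≤ j).card : ℝ) =
        ∑ p ∈ S, (if isC p then (1 : ℝ) else 0) * ∑ j ∈ Finset.Ico (κ p) (M + 1), q ^ j := by
      have : ∀ j ∈ Finset.range (M + 1), q ^ j * ((S.filter fun p => isC p ∧ κ p ≤ j).card : ℝ) =
          ∑ p ∈ S, (if isC p ∧ κ p ≤ j then q ^ j else 0) := by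
        intro j _
        rw [Finset.card_filter, Nat.cast_sum, Finset.mul_sum]
        refine Finset.sum_congr rfl fun p _ => ?_
        by_cases h : isC p ∧ κ p ≤ j
        · rw [if_pos h, if_pos h, Nat.cast_one, mul_one]
        · rw [if_neg h, if_neg h, Nat.cast_zero, mul_zero]
      rw [Finset.sum_congr rfl this, Finset.sum_comm]
      refine Finset.sum_congr rfl fun p hp => ?_
      by_cases hC : isC p
      · rw [if_pos hC, one_mul, Finset.sum_ite, Finset.sum_const_zero, add_zero]
        apply Finset.sum_congr
        · ext j
          simp only [Finset.mem_filter, Finset.mem_range, Finset.mem_Ico, hC, true_and]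
          omega
        · intro j _; rfl
      · rw [if_neg hC, zero_mul]
        exact Finset.sum_eq_zero fun j _ => by rw [if_neg (fun h => hC h.1)]
    rw [hcum, Finset.mul_sum]
    refine Finset.sum_le_sum fun p hp => ?_
    by_cases hC : isC p
    · rw [if_pos hC, one_mul, mul_one, one_sub_mul_geom_Ico]
      have hqk : 0 ≤ q ^ κ p := pow_nonneg hq0 _
      have : 0 ≤ q ^ (M + 1 - κ p) := pow_nonneg hq0 _
      nlinarith
    · rw [if_neg hC, zero_mul, mul_zero, mul_zero]
  -- assemble
  have split : ∑ p ∈ S, q ^ κ p * ((if isC p then (1 : ℝ) else 0) +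
      (1 - q) * ((if isAB p then (1 : ℝ) else 0) - (if isBad p then (1 : ℝ) else 0))) =
      ∑ p ∈ S, q ^ κ p * (if isC p then (1 : ℝ) else 0) +
        (1 - q) * (∑ p ∈ S, q ^ κ p * (if isAB p then (1 : ℝ) else 0) -
          ∑ p ∈ S, q ^ κ p * (if isBad p then (1 : ℝ) else 0)) := by
    rw [mul_sub, Finset.mul_sum, Finset.mul_sum, ← Finset.sum_sub_distrib, ← Finset.sum_add_distrib]
    exact Finset.sum_congr rfl fun p _ => by ring
  rw [split, lev isAB, lev isBad]
  have key : (1 - q) * (∑ j ∈ Finset.range (M + 1), q ^ j * ((S.filter fun p => isBad p ∧ κ p = j).card : ℝ)) ≤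
      (1 - q) * ∑ j ∈ Finset.range (M + 1), q ^ j * ((S.filter fun p => isC p ∧ κ p ≤ j).card : ℝ) +
        (1 - q) * ∑ j ∈ Finset.range (M + 1), q ^ j * ((S.filter fun p => isAB p ∧ κ p = j).card : ℝ) := by
    rw [← mul_add, ← Finset.sum_add_distrib]
    refine mul_le_mul_of_nonneg_left (Finset.sum_le_sum fun j _ => ?_) h1q
    rw [← mul_add]
    exact mul_le_mul_of_nonneg_left (hcount j) (pow_nonneg hq0 _)
  linarith [domC, key]

/-! ### The hub covariance bound from the counting criterion -/

/-- **Hub covariance bound from fiber counting** (`0 < q ≤ 1`): if for every fiber `(I, J)` of pairs of configurations and every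
level `j` the number of BAD pairs `(ω₁ ∈ {x↔y↔z}, ω₂ ∈ {x ∤ y~z} ∪ {x|y|z})` of level `j = k(ω₁)+k(ω₂)` is at most the number of
C-GOOD pairs `(ω₁ ∈ {x∤y, y~z})` of level `≤ j` plus the number of AB-GOOD pairs `(ω₁ ∈ {xy|z}, ω₂ ∈ {xz|y})` of level `j`, then
`HubCovBoundUnder (φ_{U,q}) q x y z` — for every weight vector `U`.  With fk-3's `negCorr_adj_of_threePoint` /
`…HubCovEquiv` this is a `q`-free sufficient condition for negative correlation of the adjacent pairs `xy, xz` at every `q ∈ (0,1)`.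
[cite: Wagner2006, Conj. 5.3, Conj. 5.4 (p. 13)] [cite: Grimmett2006, §3.9 eq. (3.94) (pp. 63–64)] -/
theorem hubCovBoundUnder_of_fiberCount {q : ℝ} (hq0 : 0 < q) (hq1 : q ≤ 1) (U : Sym2 V → unitInterval) (x y z : V)
    (hcount : ∀ (d : BondConfig V × BondConfig V) (j : ℕ),
      ((((Finset.univ : Finset (BondConfig V × BondConfig V)).filter (fun pr => (pr.1 ∩ pr.2, pr.1 ∪ pr.2) = d)).filter
          (fun pr => (pr.1 ∈ (openConn x y ∩ openConn x z : Set (BondConfig V)) ∧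
            pr.2 ∈ (((openConn x y : Set (BondConfig V))ᶜ ∩ openConn y z) ∪
              ((openConn x y : Set (BondConfig V))ᶜ ∩ (openConn x z : Set (BondConfig V))ᶜ ∩
                (openConn y z : Set (BondConfig V))ᶜ) : Set (BondConfig V))) ∧
            clusterCount pr.1 ∅ + clusterCount pr.2 ∅ = j)).card : ℝ) ≤
        ((((Finset.univ : Finset (BondConfig V × BondConfig V)).filter (fun pr => (pr.1 ∩ pr.2, pr.1 ∪ pr.2) = d)).filter
          (fun pr => pr.1 ∈ ((openConn x y : Set (BondConfig V))ᶜ ∩ openConn y z : Set (BondConfig V)) ∧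
            clusterCount pr.1 ∅ + clusterCount pr.2 ∅ ≤ j)).card : ℝ) +
        ((((Finset.univ : Finset (BondConfig V × BondConfig V)).filter (fun pr => (pr.1 ∩ pr.2, pr.1 ∪ pr.2) = d)).filter
          (fun pr => (pr.1 ∈ (openConn x y ∩ (openConn x z : Set (BondConfig V))ᶜ : Set (BondConfig V)) ∧
            pr.2 ∈ ((openConn x y : Set (BondConfig V))ᶜ ∩ openConn x z : Set (BondConfig V))) ∧
            clusterCount pr.1 ∅ + clusterCount pr.2 ∅ = j)).card : ℝ)) :
    HubCovBoundUnder (rcMeasureW U q ∅) q x y z := by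
  rw [hubCovBoundUnder_iff_threePoint hq0, threePoint_eq_fiber_sum]
  refine Finset.sum_nonneg fun d _ => mul_nonneg (fiberWeight_nonneg _ (fun g => (U g).2.1) (fun g => (U g).2.2) _ _) ?_
  -- match the shape of `fiberPoly_nonneg_of_count`
  have key := fiberPoly_nonneg_of_count
    ((Finset.univ : Finset (BondConfig V × BondConfig V)).filter (fun pr => (pr.1 ∩ pr.2, pr.1 ∪ pr.2) = d))
    (fun pr => clusterCount pr.1 ∅ + clusterCount pr.2 ∅)
    (fun pr => pr.1 ∈ ((openConn x y : Set (BondConfig V))ᶜ ∩ openConn y z : Set (BondConfig V)))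
    (fun pr => pr.1 ∈ (openConn x y ∩ (openConn x z : Set (BondConfig V))ᶜ : Set (BondConfig V)) ∧
      pr.2 ∈ ((openConn x y : Set (BondConfig V))ᶜ ∩ openConn x z : Set (BondConfig V)))
    (fun pr => pr.1 ∈ (openConn x y ∩ openConn x z : Set (BondConfig V)) ∧
      pr.2 ∈ (((openConn x y : Set (BondConfig V))ᶜ ∩ openConn y z) ∪
        ((openConn x y : Set (BondConfig V))ᶜ ∩ (openConn x z : Set (BondConfig V))ᶜ ∩
          (openConn y z : Set (BondConfig V))ᶜ) : Set (BondConfig V)))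
    hq0.le hq1 (hcount d)
  refine le_trans key (le_of_eq (Finset.sum_congr rfl fun pr _ => ?_))
  -- indicators: `if … then 1 else 0` versus `ind`, and the disjoint union for the bad pairs
  have vAB1 : pr.1 ∈ (openConn x y ∩ (openConn x z : Set (BondConfig V))ᶜ : Set (BondConfig V)) ∧
      pr.2 ∈ ((openConn x y : Set (BondConfig V))ᶜ ∩ openConn x z : Set (BondConfig V)) →
      ind (openConn x y ∩ (openConn x z : Set (BondConfig V))ᶜ) pr.1 *
        ind ((openConn x y : Set (BondConfig V))ᶜ ∩ openConn x z) pr.2 = 1 := by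
    rintro ⟨h1, h2⟩; rw [ind_of_mem h1, ind_of_mem h2, mul_one]
  have vAB0 : ¬ (pr.1 ∈ (openConn x y ∩ (openConn x z : Set (BondConfig V))ᶜ : Set (BondConfig V)) ∧
      pr.2 ∈ ((openConn x y : Set (BondConfig V))ᶜ ∩ openConn x z : Set (BondConfig V))) →
      ind (openConn x y ∩ (openConn x z : Set (BondConfig V))ᶜ) pr.1 *
        ind ((openConn x y : Set (BondConfig V))ᶜ ∩ openConn x z) pr.2 = 0 := by
    intro h
    by_cases h1 : pr.1 ∈ (openConn x y ∩ (openConn x z : Set (BondConfig V))ᶜ : Set (BondConfig V))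
    · rw [ind_of_not_mem (fun h2 => h ⟨h1, h2⟩), mul_zero]
    · rw [ind_of_not_mem h1, zero_mul]
  have vBad1 : pr.1 ∈ (openConn x y ∩ openConn x z : Set (BondConfig V)) ∧
      pr.2 ∈ (((openConn x y : Set (BondConfig V))ᶜ ∩ openConn y z) ∪
        ((openConn x y : Set (BondConfig V))ᶜ ∩ (openConn x z : Set (BondConfig V))ᶜ ∩
          (openConn y z : Set (BondConfig V))ᶜ) : Set (BondConfig V)) →
      ind (openConn x y ∩ openConn x z) pr.1 *
        (ind ((openConn x y : Set (BondConfig V))ᶜ ∩ openConn y z) pr.2 +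
          ind ((openConn x y : Set (BondConfig V))ᶜ ∩ (openConn x z : Set (BondConfig V))ᶜ ∩
            (openConn y z : Set (BondConfig V))ᶜ) pr.2) = 1 := by
    rintro ⟨h1, h2⟩
    rw [ind_of_mem h1, one_mul]
    rcases h2 with h2 | h2
    · have h3 : pr.2 ∉ ((openConn x y : Set (BondConfig V))ᶜ ∩ (openConn x z : Set (BondConfig V))ᶜ ∩
          (openConn y z : Set (BondConfig V))ᶜ : Set (BondConfig V)) := fun h => h.2 h2.2
      rw [ind_of_mem h2, ind_of_not_mem h3, add_zero]
    · have h3 : pr.2 ∉ ((openConn x y : Set (BondConfig V))ᶜ ∩ openConn y z : Set (BondConfig V)) := fun h => h2.2 h.2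
      rw [ind_of_not_mem h3, ind_of_mem h2, zero_add]
  have vBad0 : ¬ (pr.1 ∈ (openConn x y ∩ openConn x z : Set (BondConfig V)) ∧
      pr.2 ∈ (((openConn x y : Set (BondConfig V))ᶜ ∩ openConn y z) ∪
        ((openConn x y : Set (BondConfig V))ᶜ ∩ (openConn x z : Set (BondConfig V))ᶜ ∩
          (openConn y z : Set (BondConfig V))ᶜ) : Set (BondConfig V))) →
      ind (openConn x y ∩ openConn x z) pr.1 *
        (ind ((openConn x y : Set (BondConfig V))ᶜ ∩ openConn y z) pr.2 +
          ind ((openConn x y : Set (BondConfig V))ᶜ ∩ (openConn x z : Set (BondConfig V))ᶜ ∩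
            (openConn y z : Set (BondConfig V))ᶜ) pr.2) = 0 := by
    intro h
    by_cases h1 : pr.1 ∈ (openConn x y ∩ openConn x z : Set (BondConfig V))
    · have h2 : pr.2 ∉ (((openConn x y : Set (BondConfig V))ᶜ ∩ openConn y z) ∪
          ((openConn x y : Set (BondConfig V))ᶜ ∩ (openConn x z : Set (BondConfig V))ᶜ ∩
            (openConn y z : Set (BondConfig V))ᶜ) : Set (BondConfig V)) := fun h2 => h ⟨h1, h2⟩
      rw [ind_of_not_mem (fun h' => h2 (Set.mem_union_left _ h')), ind_of_not_mem (fun h' => h2 (Set.mem_union_right _ h')),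
        add_zero, mul_zero]
    · rw [ind_of_not_mem h1, zero_mul]
  have vC1 : pr.1 ∈ ((openConn x y : Set (BondConfig V))ᶜ ∩ openConn y z : Set (BondConfig V)) →
      ind ((openConn x y : Set (BondConfig V))ᶜ ∩ openConn y z) pr.1 = 1 := fun h => ind_of_mem h
  have vC0 : pr.1 ∉ ((openConn x y : Set (BondConfig V))ᶜ ∩ openConn y z : Set (BondConfig V)) →
      ind ((openConn x y : Set (BondConfig V))ᶜ ∩ openConn y z) pr.1 = 0 := fun h => ind_of_not_mem h
  split_ifs <;>
    (first | rw [vC1 (by assumption)] | rw [vC0 (by assumption)]) <;>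
    (first | rw [vAB1 (by assumption)] | rw [vAB0 (by assumption)]) <;>
    (first | rw [vBad1 (by assumption)] | rw [vBad0 (by assumption)])

end FK

end Summit.CriticalPhenomena.PercolationContinuityZ3.Theorems

end
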